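import Literature.MathematicalPhysics.QuantumFieldTheory.Balaban1983to89.T4CouplingMatching

/-!
# EriceRemainderEnclosureHistoryRenewal — (E33a) IS FADING MEMORY IDLE FOR THE CONTINUUM COUPLING TOO?  Part 1: NE4 as typed
# (`ScaleShiftRate`) already makes the OSCILLATION of `β` in its old entries fade, whatever their Lipschitz modulus; hence each row
# of node U2's two-run recursion splits into a fading-oscillation tail plus a Lipschitz part over a WINDOW of recent scales that
# costs only the ROW TOTAL WEIGHT of the history modulus — NO `FadingMemory`

Cell `pub-balaban`, β-function sub-cell, BINDER row D4 «RemainderConst leaves for Bałaban's split» (`HOME/BINDER-OWNERS.md`; owner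
lineage `b2b-balaban-beta-an4`; this file by co-owner #2 lineage `b2b-balaban-beta-d4-p2`, generation 35), β-FLOW TEAM duty (1),
FREEZE (0) honoured (def-free module in the lineage's `EriceRemainderEnclosure*` series; no new leaf, no new hypothesis shape).  Sequel
of (E32) `EriceRemainderEnclosureHistoryUniqueness` (p336595: the UNIQUENESS leg needs no memory decay) on the RATE ∕ EXISTENCE leg, over
node U2's `T4CouplingMatching` (lineage `b2b-balaban-pv16`; `disc`, `disc_step`, `abs_sub_le_of_inv_sq`, `tail_prefixOf` BY NAME).
Companions: (E33b) `EriceRemainderEnclosureHistoryRenewalBlocks` (the block renewal across infrared distances, abstract), (E33c)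
`EriceRemainderEnclosureHistoryRenewalRate` (run level: node U2's matching WITHOUT `FadingMemory`, stretched-exponential rate), (E33d)
`EriceRemainderEnclosureHistoryRenewalContinuum` (fixed infrared distance: summability, the continuum recursion variable, node U6's sum).

HONEST FRAMING (page 1, verbatim and binding).  *"Discharging BetaPertH makes Bałaban's UV stability UNCONDITIONAL — a real
constructive-QFT result; it is NOT the continuum limit and NOT the Clay problem."*  THIS FILE DISCHARGES NOTHING OF THE KIND.  It is
elementary real analysis on node U2's typed HYPOTHESIS SHAPES over an ABSTRACT family `β : FlowStep.HBeta` — `ScaleShiftRate c θ γ β`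
(NE4 for the full β; NOT PRINTED, GAPS G-t4-U2-1) and `HistLipschitz Λ γ β` (NOT PRINTED, GAPS G-t4-U2-2; [I] p. 298 says only that the
dependence on the preceding couplings exists) — NONE asserted for [I] (1.22).  Nothing of Bałaban's is quoted newly: the loci behind
the shapes ((0.20) p. 256, p. 264, p. 298) are quoted verbatim in the headers of `FlowStep` and `T4CouplingMatching`.  Row D4 class
UNCHANGED (critical-path width 0; instance 0∕1; D4 DISCHARGE NO DATE).  HONEST DEPENDENCY: continuum YM on T⁴ ⇐ BetaPertH ∧ nine spine
estimates (0/9 proved); BetaPertH ⇐ (D1) ∧ (D4) ∧ CAP+tail; G-an2-4 gates asym, D1 and NE2/3/4.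

THE POINT (census sense (α); the history channel's RATE row, complement of (E32)).  Node U2 closes the two-sided coupling-matching
recursion `δ_j ≤ δ_{j+1} + cθ^j + Σ_{i≤j} Λ j i·u_i·δ_i` (`u_i = (g^A_i)²g^B_{i+1}`, `δ = disc gA gB`, pin `δ_K = 0`) with the DECAY
hypothesis `FadingMemory C θ Λ` and obtains the GEOMETRIC shape `δ_j ≤ (2c∕(1−θ))·θ^j` (`disc_le_of_fadingMemory`), the typed source
`T4CauchySum.InjectedRate C 0 θ` of node U6 and of `T4ContinuumCoupling`.  The observation of this file: NE4 AS TYPED —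
`ScaleShiftRate c θ γ β`: deleting the OLDEST coupling of a history in the box moves `β` by `≤ cθ^k` — already forces, by deleting the
old couplings one at a time (§1), that two histories agreeing on their `s + 1` most recent entries have `β`-values within
`2cθ^s∕(1−θ)`, WHATEVER the Lipschitz modulus of the older entries (a non-fading modulus is then carried by fast small-amplitude
wiggles only).  This is the phenomenon of node U2's `T4BetaStationary` §2 (lineage `t4-ne4-p2`: `geomRate_of_scaleShiftRate`,
`abs_beta_sub_betaInf_padHist_le` — every lattice β-function IS the one limit functional `betaInf` of its own history up to
`cθ^k∕(1−θ)`), here in the finite-prefix, two-sequence form the two-run recursion needs (§1 is proved directly from `ScaleShiftRate`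
and `tail_prefixOf`, so that this file imports `T4CouplingMatching` only).  Consequently (§2) every row of node U2's recursion splits,
for any window `s`, as
`δ_j ≤ δ_{j+1} + cθ^j + 2cθ^s∕(1−θ) + A³·M·u_j·(max of δ over [j−s, j])`: the scale shift at B's couplings, the deletion of the `j − s`
oldest couplings of BOTH histories, and the history shift over the window through the modulus of `β_s` — whose ROW total weight
`Σ_{i≤s} Λ s i ≤ M` is all that enters ((D4-J2)'s junction currency, as in (E32)) — with the near-monotone AF weights of (E32)
(`u_i ≤ A³u_j`, `i ≤ j`: asymptotic freedom orders the history).  NO `FadingMemory`, no column bound, no moment.  The companions renew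
this split across infrared distances ((E33b)) into the stretched-exponential matching rate `δ_j ≤ c∕((1−θ)(1−q))·(2K+2)·max(θ,q)^⌊√j⌋`,
`q = A³MU < 1` ((E33c)), summable at every fixed infrared distance ((E33d)): the decay hypothesis buys the geometric SHAPE of node U2's
rate (and its K-uniform constant), not the existence of the continuum coupling.

WHAT IS PROVED ([folklore] real analysis over the tree's shapes; 0 `def`, 0 sorry; nothing of [I] asserted).
 §1 `abs_sub_shift_le`, `abs_sub_shift_le_geom` — FADING OSCILLATION from `ScaleShiftRate` alone: deleting the `r` oldest couplings of a
    history in the box moves `β` by `≤ Σ_{n∈[l,l+r)} cθ^n ≤ cθ^l∕(1−θ)`, `l` = number of kept older scales, uniformly in `r`.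
 §2 `disc_raw_step` (the two (0.20)'s subtracted), `weight_le_of_nearMono`, **`disc_row_window`** (`s ≤ j`), `disc_row_full` (no deletion;
    node U2's `disc_step` BY NAME with its column sum collapsed onto the row), **`disc_row_split`** (every row `j < K`, window `s`,
    ℕ-subtraction convention `[j − s, j]`) — the hypothesis `hrec` of (E33b)'s block renewal with `a_j = cθ^j`, `e = 2cθ^s∕(1−θ)`,
    `m = A³M`, `w_j = (g^A_j)²g^B_{j+1}`.
-/

noncomputable section
open Finset

namespace Summit.QuantumFields.BalabanUV.Beta.EriceRemainderEnclosureHistoryRenewal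

open Literature.MathematicalPhysics.QuantumFieldTheory.Balaban1983to89
open Literature.MathematicalPhysics.QuantumFieldTheory.Balaban1983to89.FlowStep
open Literature.MathematicalPhysics.QuantumFieldTheory.Balaban1983to89.T4CouplingMatching

/-! ## §1 Fading OSCILLATION from the scale-shift rate alone -/

/-- **FADING OSCILLATION FROM THE SCALE-SHIFT RATE.**  Under `ScaleShiftRate c θ γ β`, for a sequence `g` with `g i ∈ ]0,γ]` for
`i ≤ l + r`: `|β (l + r) (g_0, …, g_{l+r}) − β l (g_r, …, g_{l+r})| ≤ Σ_{n ∈ [l, l+r)} c·θ^n` — deleting the `r` OLDEST couplings moves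
`β` by a geometric tail that depends on the number `l` of KEPT older scales only (induction on `r`, node U2's `tail_prefixOf`).  NE4 is
NOT PRINTED (GAPS G-t4-U2-1); hypothesis, never fact. [cite: Balaban1987RG1, (0.20) p.256 and §5 p.298] -/
theorem abs_sub_shift_le {β : HBeta} {c θ γ : ℝ} (hS : ScaleShiftRate c θ γ β) :
    ∀ (r l : ℕ) (g : ℕ → ℝ), (∀ i, i ≤ l + r → 0 < g i ∧ g i ≤ γ) →
      |β (l + r) (prefixOf g (l + r)) - β l (prefixOf (fun n => g (n + r)) l)| ≤ ∑ n ∈ Ico l (l + r), c * θ ^ n := by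
  intro r
  induction r with
  | zero =>
    intro l g _
    simp
  | succ r ih =>
    intro l g hg
    have hbox : prefixOf g (l + r + 1) ∈ Box γ (l + r + 1) := prefixOf_mem_box le_rfl (by simpa [Nat.add_assoc] using hg)
    have h1 : |β (l + r + 1) (prefixOf g (l + r + 1)) - β (l + r) (prefixOf (fun n => g (n + 1)) (l + r))| ≤ c * θ ^ (l + r) := by
      have h := hS (l + r) (prefixOf g (l + r + 1)) hbox
      rwa [tail_prefixOf] at h
    have h2 := ih l (fun n => g (n + 1)) (fun i hi => hg (i + 1) (by omega))
    have e : (fun n => (fun m => g (m + 1)) (n + r)) = fun n => g (n + (r + 1)) := by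
      funext n; simp only [Nat.add_assoc, Nat.add_comm r 1]
    rw [e] at h2
    rw [show l + (r + 1) = l + r + 1 by omega, sum_Ico_succ_top (by omega : l ≤ l + r)]
    calc |β (l + r + 1) (prefixOf g (l + r + 1)) - β l (prefixOf (fun n => g (n + (r + 1))) l)|
        ≤ |β (l + r + 1) (prefixOf g (l + r + 1)) - β (l + r) (prefixOf (fun n => g (n + 1)) (l + r))|
          + |β (l + r) (prefixOf (fun n => g (n + 1)) (l + r)) - β l (prefixOf (fun n => g (n + (r + 1))) l)| :=
          abs_sub_le _ _ _
      _ ≤ c * θ ^ (l + r) + ∑ n ∈ Ico l (l + r), c * θ ^ n := add_le_add h1 h2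
      _ = ∑ n ∈ Ico l (l + r), c * θ ^ n + c * θ ^ (l + r) := by ring

/-- **UNIFORMLY IN THE NUMBER OF DELETED COUPLINGS**: under `ScaleShiftRate c θ γ β` (`c ≥ 0`, `0 ≤ θ < 1`), deleting ANY number `r`
of oldest couplings moves `β` by at most `c·θ^l∕(1−θ)`, `l` = the number of kept older scales: the OSCILLATION of `β` in its entries
of age `> l` fades geometrically in `l`, whatever the Lipschitz modulus of those entries. [folklore] -/
theorem abs_sub_shift_le_geom {β : HBeta} {c θ γ : ℝ} (hS : ScaleShiftRate c θ γ β) (hc : 0 ≤ c) (hθ0 : 0 ≤ θ)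
    (hθ1 : θ < 1) (r l : ℕ) (g : ℕ → ℝ) (hg : ∀ i, i ≤ l + r → 0 < g i ∧ g i ≤ γ) :
    |β (l + r) (prefixOf g (l + r)) - β l (prefixOf (fun n => g (n + r)) l)| ≤ c * θ ^ l / (1 - θ) := by
  refine (abs_sub_shift_le hS r l g hg).trans ?_
  rw [← mul_sum]
  calc c * ∑ n ∈ Ico l (l + r), θ ^ n ≤ c * (θ ^ l / (1 - θ)) :=
        mul_le_mul_of_nonneg_left (geom_sum_Ico_le_of_lt_one hθ0 hθ1) hc
    _ = c * θ ^ l / (1 - θ) := by ring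

/-! ## §2 The row split of node U2's two-run recursion with a window of `s` scales -/

/-- THE RAW STEP of node U2's two-run recursion (runs of lengths `K` and `K + 1`, the same history family `β`): subtracting (0.20) of
run A at step `j` from (0.20) of run B at the infrared-matched step `j + 1` gives
`disc_j ≤ disc_{j+1} + |β_j(g^A_0, …, g^A_j) − β_{j+1}(g^B_0, …, g^B_{j+1})|`. [cite: Balaban1987RG1, (0.20) p.256] -/
theorem disc_raw_step {β : HBeta} {K : ℕ} {gA gB : ℕ → ℝ} (hA : RGEqH K β gA) (hB : RGEqH (K + 1) β gB)
    {j : ℕ} (hj : j < K) :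
    disc gA gB j ≤ disc gA gB (j + 1) + |β j (prefixOf gA j) - β (j + 1) (prefixOf gB (j + 1))| := by
  have eA := hA j hj
  have eB := hB (j + 1) (by omega)
  have key : 1 / gA j ^ 2 - 1 / gB (j + 1) ^ 2
      = (1 / gA (j + 1) ^ 2 - 1 / gB (j + 2) ^ 2) + (β j (prefixOf gA j) - β (j + 1) (prefixOf gB (j + 1))) := by
    rw [eA, eB]; ring
  simp only [disc]
  rw [key]
  exact abs_add_le _ _

/-- Near-monotone runs have near-monotone AF weights: `g^X_i ≤ A·g^X_j` (`i ≤ j`) for both runs gives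
`(g^A_i)²g^B_{i+1} ≤ A³·(g^A_j)²g^B_{j+1}` for `i ≤ j ≤ K`. [folklore] -/
theorem weight_le_of_nearMono {A : ℝ} {K : ℕ} {gA gB : ℕ → ℝ}
    (hApos : ∀ i, i ≤ K → 0 < gA i) (hBpos : ∀ i, i ≤ K + 1 → 0 < gB i)
    (hmA : ∀ i j, i ≤ j → j ≤ K → gA i ≤ A * gA j) (hmB : ∀ i j, i ≤ j → j ≤ K + 1 → gB i ≤ A * gB j)
    {i j : ℕ} (hij : i ≤ j) (hjK : j ≤ K) :
    (gA i) ^ 2 * gB (i + 1) ≤ A ^ 3 * ((gA j) ^ 2 * gB (j + 1)) := by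
  have h1 := hmA i j hij hjK
  have h2 := hmB (i + 1) (j + 1) (by omega) (by omega)
  have hgAi := hApos i (hij.trans hjK)
  have hgBi := hBpos (i + 1) (by omega)
  have hsq : (gA i) ^ 2 ≤ (A * gA j) ^ 2 := pow_le_pow_left₀ hgAi.le h1 2
  calc (gA i) ^ 2 * gB (i + 1) ≤ (A * gA j) ^ 2 * (A * gB (j + 1)) :=
        mul_le_mul hsq h2 hgBi.le (by positivity)
    _ = A ^ 3 * ((gA j) ^ 2 * gB (j + 1)) := by ring

/-- **THE ROW SPLIT, WINDOWED ROW** (`s ≤ j < K`).  Two runs of (0.20) (A: `K` steps, B: `K + 1` steps) in ]0,γ] with the same `β`,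
NE4 as `ScaleShiftRate c θ γ β` (`c ≥ 0`, `0 ≤ θ < 1`), `HistLipschitz Λ γ β` with nonnegative moduli of k-uniform ROW total weight
`Σ_{i≤k} Λ k i ≤ M`, near-monotone runs (constant `A ≥ 0`).  If `B′` bounds `disc` on the window `[j − s, j]`, then
`disc_j ≤ disc_{j+1} + cθ^j + 2·cθ^s∕(1−θ) + A³·M·(g^A_j)²g^B_{j+1}·B′`: the scale shift at B's couplings (`≤ cθ^j`), the deletion of the
`j − s` oldest couplings of BOTH histories (§1, `≤ cθ^s∕(1−θ)` each), and the history shift over the window through the modulus of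
`β_s` (row `≤ M`), `abs_sub_le_of_inv_sq` and the near-monotone weights.  NO `FadingMemory`.  Hypotheses, never facts.
[cite: Balaban1987RG1, (0.20) p.256 and §5 p.298] -/
theorem disc_row_window {β : HBeta} {γ c θ M A : ℝ} {Λ : ℕ → ℕ → ℝ} {K s : ℕ} {gA gB : ℕ → ℝ}
    (hc : 0 ≤ c) (hθ0 : 0 ≤ θ) (hθ1 : θ < 1)
    (hA : RGEqH K β gA) (hB : RGEqH (K + 1) β gB)
    (hAbox : ∀ i, i ≤ K → 0 < gA i ∧ gA i ≤ γ) (hBbox : ∀ i, i ≤ K + 1 → 0 < gB i ∧ gB i ≤ γ)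
    (hS : ScaleShiftRate c θ γ β) (hL : HistLipschitz Λ γ β) (hΛ : ∀ k i, i ≤ k → 0 ≤ Λ k i)
    (hrow : ∀ k, ∑ i ∈ range (k + 1), Λ k i ≤ M) (hA0 : 0 ≤ A)
    (hmA : ∀ i j, i ≤ j → j ≤ K → gA i ≤ A * gA j) (hmB : ∀ i j, i ≤ j → j ≤ K + 1 → gB i ≤ A * gB j)
    {j : ℕ} (hj : j < K) (hsj : s ≤ j) {B' : ℝ} (hB' : ∀ i, j - s ≤ i → i ≤ j → disc gA gB i ≤ B') :
    disc gA gB j ≤ disc gA gB (j + 1) + c * θ ^ j + 2 * (c * θ ^ s / (1 - θ))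
      + A ^ 3 * M * ((gA j) ^ 2 * gB (j + 1)) * B' := by
  obtain ⟨r, rfl⟩ : ∃ r, j = s + r := ⟨j - s, by omega⟩
  -- the four pieces
  set gB' : ℕ → ℝ := fun n => gB (n + 1) with hgB'
  have hB'box : ∀ i, i ≤ K → 0 < gB' i ∧ gB' i ≤ γ := fun i hi => hBbox (i + 1) (by omega)
  -- (i) scale shift at B's couplings
  have h1 : |β (s + r + 1) (prefixOf gB (s + r + 1)) - β (s + r) (prefixOf gB' (s + r))| ≤ c * θ ^ (s + r) := by
    have h := hS (s + r) (prefixOf gB (s + r + 1)) (prefixOf_mem_box (by omega) hBbox)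
    rwa [tail_prefixOf] at h
  -- (ii) deletion of the r oldest couplings of A and of B'
  have h2A : |β (s + r) (prefixOf gA (s + r)) - β s (prefixOf (fun n => gA (n + r)) s)| ≤ c * θ ^ s / (1 - θ) :=
    abs_sub_shift_le_geom hS hc hθ0 hθ1 r s gA fun i hi => hAbox i (by omega)
  have h2B : |β (s + r) (prefixOf gB' (s + r)) - β s (prefixOf (fun n => gB' (n + r)) s)| ≤ c * θ ^ s / (1 - θ) :=
    abs_sub_shift_le_geom hS hc hθ0 hθ1 r s gB' fun i hi => hB'box i (by omega)
  -- (iii) history shift over the window, through the modulus of β_s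
  have hpA : prefixOf (fun n => gA (n + r)) s ∈ Box γ s :=
    prefixOf_mem_box (N := s) le_rfl fun i hi => hAbox (i + r) (by omega)
  have hpB : prefixOf (fun n => gB' (n + r)) s ∈ Box γ s :=
    prefixOf_mem_box (N := s) le_rfl fun i hi => hB'box (i + r) (by omega)
  have h3 := hL s _ _ hpA hpB
  have hB'0 : 0 ≤ B' := (disc_nonneg gA gB (s + r)).trans (hB' (s + r) (by omega) le_rfl)
  have huj : 0 ≤ (gA (s + r)) ^ 2 * gB (s + r + 1) := mul_nonneg (sq_nonneg _) (hBbox _ (by omega)).1.le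
  have h4 : ∑ i : Fin (s + 1), Λ s i * |prefixOf (fun n => gA (n + r)) s i - prefixOf (fun n => gB' (n + r)) s i|
      ≤ M * (A ^ 3 * ((gA (s + r)) ^ 2 * gB (s + r + 1)) * B') := by
    calc ∑ i : Fin (s + 1), Λ s i * |prefixOf (fun n => gA (n + r)) s i - prefixOf (fun n => gB' (n + r)) s i|
        ≤ ∑ i : Fin (s + 1), Λ s i * (A ^ 3 * ((gA (s + r)) ^ 2 * gB (s + r + 1)) * B') := by
          refine sum_le_sum fun i _ => ?_
          have his : (i : ℕ) ≤ s := Nat.lt_succ_iff.mp i.isLt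
          have hiK : (i : ℕ) + r ≤ K := by omega
          have hgA := hAbox (i + r) hiK
          have hgB := hBbox (i + r + 1) (by omega)
          refine mul_le_mul_of_nonneg_left ?_ (hΛ s i his)
          simp only [prefixOf_apply, hgB']
          calc |gA (i + r) - gB (i + r + 1)|
              ≤ (gA (i + r)) ^ 2 * gB (i + r + 1) * |1 / (gA (i + r)) ^ 2 - 1 / (gB (i + r + 1)) ^ 2| :=
                abs_sub_le_of_inv_sq hgA.1 hgB.1
            _ ≤ (A ^ 3 * ((gA (s + r)) ^ 2 * gB (s + r + 1))) * B' := by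
                refine mul_le_mul (weight_le_of_nearMono (fun i hi => (hAbox i hi).1) (fun i hi => (hBbox i hi).1)
                  hmA hmB (by omega) (by omega)) (hB' (i + r) (by omega) (by omega)) (abs_nonneg _) (by positivity)
            _ = A ^ 3 * ((gA (s + r)) ^ 2 * gB (s + r + 1)) * B' := by ring
      _ = (∑ i : Fin (s + 1), Λ s i) * (A ^ 3 * ((gA (s + r)) ^ 2 * gB (s + r + 1)) * B') := by rw [sum_mul]
      _ ≤ M * (A ^ 3 * ((gA (s + r)) ^ 2 * gB (s + r + 1)) * B') := by
          refine mul_le_mul_of_nonneg_right ?_ (by positivity)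
          have hr := hrow s
          rwa [Finset.sum_range (fun i => Λ s i)] at hr
  -- assemble
  have hraw := disc_raw_step hA hB hj
  have htri : |β (s + r) (prefixOf gA (s + r)) - β (s + r + 1) (prefixOf gB (s + r + 1))|
      ≤ c * θ ^ (s + r) + c * θ ^ s / (1 - θ) + c * θ ^ s / (1 - θ)
        + M * (A ^ 3 * ((gA (s + r)) ^ 2 * gB (s + r + 1)) * B') := by
    have t1 : |β (s + r) (prefixOf gA (s + r)) - β (s + r + 1) (prefixOf gB (s + r + 1))|
        ≤ |β (s + r + 1) (prefixOf gB (s + r + 1)) - β (s + r) (prefixOf gB' (s + r))|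
          + |β (s + r) (prefixOf gA (s + r)) - β (s + r) (prefixOf gB' (s + r))| := by
      rw [abs_sub_comm (β (s + r + 1) _)]
      have := abs_sub_le (β (s + r) (prefixOf gA (s + r))) (β (s + r) (prefixOf gB' (s + r)))
        (β (s + r + 1) (prefixOf gB (s + r + 1)))
      linarith
    have t2 : |β (s + r) (prefixOf gA (s + r)) - β (s + r) (prefixOf gB' (s + r))|
        ≤ |β (s + r) (prefixOf gA (s + r)) - β s (prefixOf (fun n => gA (n + r)) s)|
          + |β s (prefixOf (fun n => gA (n + r)) s) - β s (prefixOf (fun n => gB' (n + r)) s)|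
          + |β (s + r) (prefixOf gB' (s + r)) - β s (prefixOf (fun n => gB' (n + r)) s)| := by
      have u1 := abs_sub_le (β (s + r) (prefixOf gA (s + r))) (β s (prefixOf (fun n => gA (n + r)) s))
        (β (s + r) (prefixOf gB' (s + r)))
      have u2 := abs_sub_le (β s (prefixOf (fun n => gA (n + r)) s)) (β s (prefixOf (fun n => gB' (n + r)) s))
        (β (s + r) (prefixOf gB' (s + r)))
      rw [abs_sub_comm (β s (prefixOf (fun n => gB' (n + r)) s))] at u2
      linarith
    linarith [h3.trans h4]
  have e2 : c * θ ^ (s + r) + c * θ ^ s / (1 - θ) + c * θ ^ s / (1 - θ)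
        + M * (A ^ 3 * ((gA (s + r)) ^ 2 * gB (s + r + 1)) * B')
      = c * θ ^ (s + r) + 2 * (c * θ ^ s / (1 - θ)) + A ^ 3 * M * ((gA (s + r)) ^ 2 * gB (s + r + 1)) * B' := by ring
  linarith [hraw, htri, e2]

/-- **THE ROW SPLIT, FULL ROW** (any `j < K`, no deletion): if `B′` bounds `disc` on `[0, j]` then
`disc_j ≤ disc_{j+1} + cθ^j + A³·M·(g^A_j)²g^B_{j+1}·B′` — node U2's `disc_step` BY NAME with its column sum collapsed onto the ROW of the
modulus by the near-monotone weights (as in (E32)).  NO `FadingMemory`. [cite: Balaban1987RG1, (0.20) p.256 and §5 p.298] -/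
theorem disc_row_full {β : HBeta} {γ c θ M A : ℝ} {Λ : ℕ → ℕ → ℝ} {K : ℕ} {gA gB : ℕ → ℝ}
    (hA : RGEqH K β gA) (hB : RGEqH (K + 1) β gB)
    (hAbox : ∀ i, i ≤ K → 0 < gA i ∧ gA i ≤ γ) (hBbox : ∀ i, i ≤ K + 1 → 0 < gB i ∧ gB i ≤ γ)
    (hS : ScaleShiftRate c θ γ β) (hL : HistLipschitz Λ γ β) (hΛ : ∀ k i, i ≤ k → 0 ≤ Λ k i)
    (hrow : ∀ k, ∑ i ∈ range (k + 1), Λ k i ≤ M) (hA0 : 0 ≤ A)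
    (hmA : ∀ i j, i ≤ j → j ≤ K → gA i ≤ A * gA j) (hmB : ∀ i j, i ≤ j → j ≤ K + 1 → gB i ≤ A * gB j)
    {j : ℕ} (hj : j < K) {B' : ℝ} (hB' : ∀ i, i ≤ j → disc gA gB i ≤ B') :
    disc gA gB j ≤ disc gA gB (j + 1) + c * θ ^ j + A ^ 3 * M * ((gA j) ^ 2 * gB (j + 1)) * B' := by
  have hstep := disc_step hA hB hAbox hBbox hS hL hΛ hj
  have hB'0 : 0 ≤ B' := (disc_nonneg gA gB j).trans (hB' j le_rfl)
  have huj : 0 ≤ (gA j) ^ 2 * gB (j + 1) := mul_nonneg (sq_nonneg _) (hBbox _ (by omega)).1.le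
  have hsum : ∑ i ∈ range (j + 1), Λ j i * ((gA i) ^ 2 * gB (i + 1)) * disc gA gB i
      ≤ M * (A ^ 3 * ((gA j) ^ 2 * gB (j + 1)) * B') := by
    calc ∑ i ∈ range (j + 1), Λ j i * ((gA i) ^ 2 * gB (i + 1)) * disc gA gB i
        ≤ ∑ i ∈ range (j + 1), Λ j i * (A ^ 3 * ((gA j) ^ 2 * gB (j + 1)) * B') := by
          refine sum_le_sum fun i hi => ?_
          have hij : i ≤ j := Nat.lt_succ_iff.mp (mem_range.mp hi)
          rw [mul_assoc]
          refine mul_le_mul_of_nonneg_left ?_ (hΛ j i hij)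
          exact mul_le_mul (weight_le_of_nearMono (fun i hi => (hAbox i hi).1) (fun i hi => (hBbox i hi).1)
            hmA hmB hij hj.le) (hB' i hij) (disc_nonneg _ _ _) (by positivity)
      _ = (∑ i ∈ range (j + 1), Λ j i) * (A ^ 3 * ((gA j) ^ 2 * gB (j + 1)) * B') := by rw [sum_mul]
      _ ≤ M * (A ^ 3 * ((gA j) ^ 2 * gB (j + 1)) * B') := mul_le_mul_of_nonneg_right (hrow j) (by positivity)
  calc disc gA gB j ≤ disc gA gB (j + 1) + c * θ ^ j + ∑ i ∈ range (j + 1), Λ j i * ((gA i) ^ 2 * gB (i + 1)) * disc gA gB i :=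
        hstep
    _ ≤ disc gA gB (j + 1) + c * θ ^ j + M * (A ^ 3 * ((gA j) ^ 2 * gB (j + 1)) * B') := by linarith
    _ = disc gA gB (j + 1) + c * θ ^ j + A ^ 3 * M * ((gA j) ^ 2 * gB (j + 1)) * B' := by ring

/-- **THE ROW SPLIT, EVERY ROW** (`j < K`, window `s`): `disc_j ≤ disc_{j+1} + cθ^j + 2·cθ^s∕(1−θ) + A³·M·(g^A_j)²g^B_{j+1}·B′` for any
bound `B′` of `disc` on `[j − s, j]` (ℕ-subtraction: for `j < s` the window is `[0, j]` and `disc_row_full` applies, the deletion term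
being slack).  This is the hypothesis `hrec` of §3's block renewal with `a_j = cθ^j`, `e = 2cθ^s∕(1−θ)`, `m = A³M`, `w_j = (g^A_j)²g^B_{j+1}`.
[cite: Balaban1987RG1, (0.20) p.256 and §5 p.298] -/
theorem disc_row_split {β : HBeta} {γ c θ M A : ℝ} {Λ : ℕ → ℕ → ℝ} {K s : ℕ} {gA gB : ℕ → ℝ}
    (hc : 0 ≤ c) (hθ0 : 0 ≤ θ) (hθ1 : θ < 1)
    (hA : RGEqH K β gA) (hB : RGEqH (K + 1) β gB)
    (hAbox : ∀ i, i ≤ K → 0 < gA i ∧ gA i ≤ γ) (hBbox : ∀ i, i ≤ K + 1 → 0 < gB i ∧ gB i ≤ γ)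
    (hS : ScaleShiftRate c θ γ β) (hL : HistLipschitz Λ γ β) (hΛ : ∀ k i, i ≤ k → 0 ≤ Λ k i)
    (hrow : ∀ k, ∑ i ∈ range (k + 1), Λ k i ≤ M) (hA0 : 0 ≤ A)
    (hmA : ∀ i j, i ≤ j → j ≤ K → gA i ≤ A * gA j) (hmB : ∀ i j, i ≤ j → j ≤ K + 1 → gB i ≤ A * gB j)
    {j : ℕ} (hj : j < K) {B' : ℝ} (hB' : ∀ i, j - s ≤ i → i ≤ j → disc gA gB i ≤ B') :
    disc gA gB j ≤ disc gA gB (j + 1) + c * θ ^ j + 2 * (c * θ ^ s / (1 - θ))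
      + A ^ 3 * M * ((gA j) ^ 2 * gB (j + 1)) * B' := by
  rcases Nat.lt_or_ge j s with hjs | hsj
  swap
  · exact disc_row_window hc hθ0 hθ1 hA hB hAbox hBbox hS hL hΛ hrow hA0 hmA hmB hj hsj hB'
  · have hfull := disc_row_full hA hB hAbox hBbox hS hL hΛ hrow hA0 hmA hmB hj (B' := B')
      (fun i hi => hB' i (by omega) hi)
    have he : 0 ≤ 2 * (c * θ ^ s / (1 - θ)) := by
      have : 0 < 1 - θ := by linarith
      positivity
    linarith

end Summit.QuantumFields.BalabanUV.Beta.EriceRemainderEnclosureHistoryRenewal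

end
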